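import Summits.CriticalPhenomena.PercolationContinuityZ3.Theorems.PercNearOneGluingNoHeavyLowerTailSahiE3PrincipalMeetFKGLoad
import Summits.CriticalPhenomena.PercolationContinuityZ3.Theorems.PercNearOneGluingNoHeavyLowerTailC3TransportStrassen
import Mathlib.Tactic.Linarith
import Mathlib.Tactic.Ring
import HarnessLib
import HarnessLib.Audit

/-!
# `NoHeavyLowerTail` (crux stmt-CriticalPhenomena-4575), Sahi programme P4 (Holley / monotone coupling):
# Sahi's `C₃` for EVERY FKG weight when a pairwise intersection is PRINCIPAL — a cross-fibre Holley transport

Support file (cell `prim-l12`, seat P4; `--supports stmt-CriticalPhenomena-4575`).  No named facts, no sorries; standard axioms.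
Steps 1–3 of the proof (objects `starUp/satUp/fibre/coefStar/load` and their lemmas) are in the companion file
`…SahiE3PrincipalMeetFKGLoad.lean`; this file does step 4 and assembles the theorem.

## The theorem

Let `α` be a finite distributive lattice, `μ : α → ℝ` a nonnegative LOG-SUPERMODULAR weight
(`μ a · μ b ≤ μ (a ⊓ b) · μ (a ⊔ b)`, Sahi's FKG condition (8); not normalised, zero weights allowed), and let
`U, A, B` be up-sets with `A ∩ B = {x | c ≤ x}` PRINCIPAL.  Then Sahi's third functional is nonnegative:

  `latticeE3_nonneg_of_inter_eq_principalUp : 0 ≤ latticeE3 μ U A B`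

(`Literature.Probability.LatticeModels.latticeE3 = Z³·E₃`, `E₃(U,A,B) = 2μ(UAB) + μ(U)μ(A)μ(B) − μ(U)μ(AB) − μ(A)μ(UB)
− μ(B)μ(UA)` for the normalised measure).  This is the case `n = 3` of Sahi's Conjecture 5 [Sahi2008, Conj. 5;
LiebSahi2021, Conj. 1.1] — in Sahi's own generality of arbitrary FKG measures — for every triple of increasing events
ONE OF WHOSE THREE PAIRWISE INTERSECTIONS is a principal up-set (the functional is symmetric; the variants
`…_inter_eq_principalUp₁₂/₁₃` put the principal intersection in the other two positions).  It extends the seat's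
product-measure theorem `…SahiE3PrincipalMeet` (gen 3, fibre-LOCAL transport, which FAILS for non-product FKG weights:
HOME code/gen3/check_fkg_principal.py, 74 470 fibres with negative local slack) and is different in kind from the printed
proved case "one SLOT principal" [Sahi2008, Thm. 2 (product measures, class `𝒞[X]`); Blinovsky2013; tree
`Literature.Probability.LatticeModels.latticeE3_nonneg_of_principal`]: e.g. `A = X₁(X₂ ∨ f)`, `B = X₂(X₁ ∨ g)`, `U = f` on a cube
has `A ∩ B = X₁X₂` principal, no principal slot, and all three conditional correlations may be negative.
Transport reading (`…C3Transport`, `…C3TransportStrassen`): `hasC3Flow_of_inter_eq_principalUp` — for such a pair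
`(A, B)` the `C₃` supply–demand problem HAS an upward flow under every FKG weight (Strassen), although no fibre-local one.

## Proof (half a page; the file follows it literally)

Write `Z = m(univ)`, `a = m(A)`, `b = m(B)`, `P = {x | c ≤ x} = A ∩ B`, `π = m(P)`.  First-slot linearity
(`C3Transport.latticeE3_eq_sum_density`): `latticeE3 μ U A B = 2Z²·m(U ∩ P) − Σ_{x∈U} μ x · λ₀ x` with the SUPPLY coefficient
`λ₀ x = (Zπ − ab) + Za·1_B(x) + Zb·1_A(x) ≥ 0` (FKG: `ab ≤ Zπ`).
1. SATURATION.  `U' := {x | x ⊔ c ∈ U} ⊇ U` has the same trace on `P`, so `latticeE3 μ U' A B ≤ latticeE3 μ U A B`; and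
   `x ∈ U' ⟺ x ⊔ c ∈ V := U ∩ P` (an up-set of the sublattice `P`).
2. TOP SECTIONS.  `A* := {x | ∃ a' ∈ A, a' ⊓ c ≤ x} ⊇ A` and `B*` are up-sets with `A* ∩ B* = P` (if `a' ⊓ c, b' ⊓ c ≤ x`
   then `z = a' ⊔ b' ⊔ x ∈ A ∩ B = P`, so `c = c ⊓ z ≤ x` by distributivity); membership in `A*` depends on `x ⊓ c` only.
   Dominate `λ₀ ≤ λ := (Zπ − ab) + Za·1_{B*} + Zb·1_{A*}` and collect the supply along the fibres of `x ↦ x ⊔ c`: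
   `Σ_{x∈U'} μ x · λ x = Σ_{y ∈ V} H y`, `H y := Σ_{x : x ⊔ c = y} μ x · λ x` (the LOAD arriving at `y ∈ P`).
3. HOLLEY CONDITION.  For `y₁, y₂ ∈ P`: `H y₁ · μ y₂ ≤ H (y₁ ⊓ y₂) · μ (y₁ ⊔ y₂)` — termwise log-supermodularity
   `μ x · μ y₂ ≤ μ (x ⊓ y₂) · μ (x ⊔ y₂)` with `x ⊔ y₂ = y₁ ⊔ y₂`, `(x ⊓ y₂) ⊔ c = y₁ ⊓ y₂` (distributivity),
   `λ x ≤ λ (x ⊓ y₂)` (membership in `A*, B*` passes to `x ⊓ y₂` since `a' ⊓ c ≤ c ≤ y₂`), and `x ↦ x ⊓ y₂` injective on the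
   fibre (an element of a distributive lattice is determined by `x ⊓ c` and `x ⊔ c`).  I.e. the load density `H/μ` on `P` is
   DECREASING in Holley's sense, and the Ahlswede–Daykin four functions theorem (Mathlib `four_functions_theorem_univ`) on
   the FKG sublattice `P` gives `(Σ_{y∈V} H y)·m(P) ≤ (Σ_{y∈P} H y)·m(V)` for every up-set `V ⊆ P`.
4. TOTAL LOAD.  `Σ_{y∈P} H y = Σ_x μ x · λ x = Z(Zπ − ab) + Za·m(B*) + Zb·m(A*) ≤ 2Z²π`, because
   `Zπ + ab − a·m(B*) − b·m(A*) ≥ (m(A*) − a)(m(B*) − b) ≥ 0` by FKG for the up-sets `A*, B*` (`m(A*)m(B*) ≤ Z·m(A* ∩ B*) = Zπ`).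
5. Hence `Σ_{y∈V} H y ≤ 2Z²·m(V)` (if `m(P) = 0` everything vanishes), i.e. `latticeE3 μ U' A B ≥ 2Z²m(V) − Σ_{y∈V} H y ≥ 0`.
Steps 3–4 are the CROSS-FIBRE transport: the supply of a fibre is pushed to the fibre top `x ⊔ c` and then spread upward
INSIDE `P` by the Holley coupling of the load against `μ|_P`; for product weights the load density is constant on fibres of
equal shape and step 3 is vacuous (gen 3's fibre-local proof).

Exact census before formalising (seat folder work/pi/check_pfkg.py, Fractions): cubes `{0,1}^3`, `{0,1}^4` with random
log-supermodular weights `∏ αᵢ^{xᵢ} ∏ β_{ij}^{xᵢxⱼ}` (β ≥ 1), also multiplied by indicators of random sublattices (zero weights):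
3.2 M triples `(U, A, B)` with `A ∩ B` principal — `E₃ ≥ 0`, the Holley condition of step 3, the total bound of step 4 and the
saturation step: 0 violations each.
-/

namespace Summit.CriticalPhenomena.PercolationContinuityZ3.Theorems.SahiE3PrincipalMeetFKG

open Finset Literature.Probability.LatticeModels
open Summit.CriticalPhenomena.PercolationContinuityZ3.Theorems.C3Transport (HasC3Flow hasC3Flow_of_forall_upperSet)

variable {α : Type*} [DistribLattice α] [Fintype α] [DecidableEq α] [DecidableLE α]

/-! ### Step 4: the total load is at most the total capacity -/

/-- `Σ_{y ∈ P} H y = Σ_x μ x · λ x` (every point lies in exactly one fibre, over `x ⊔ c ∈ P`). [this work] -/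
theorem sum_load_eq (μ : α → ℝ) (A B : Finset α) (c : α) :
    ∑ y ∈ principalUp c, load μ A B c y = ∑ x, μ x * coefStar μ A B c x := by
  have hmaps : ∀ x ∈ (univ : Finset α), x ⊔ c ∈ principalUp c := fun x _ => mem_principalUp.2 le_sup_right
  rw [← Finset.sum_fiberwise_of_maps_to hmaps (fun x => μ x * coefStar μ A B c x)]
  rfl

/-- `Σ_x μ x · λ x = Z(Z·m(A∩B) − ab) + Za·m(B*) + Zb·m(A*)`. [this work] -/
theorem sum_mul_coefStar_eq (μ : α → ℝ) (A B : Finset α) (c : α) :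
    ∑ x, μ x * coefStar μ A B c x =
      mass μ univ * (mass μ univ * mass μ (A ∩ B) - mass μ A * mass μ B)
        + mass μ univ * mass μ A * mass μ (starUp B c) + mass μ univ * mass μ B * mass μ (starUp A c) := by
  have hpt : ∀ x, μ x * coefStar μ A B c x =
      (mass μ univ * mass μ (A ∩ B) - mass μ A * mass μ B) * μ x
        + mass μ univ * mass μ A * (μ x * (if x ∈ starUp B c then 1 else 0))
        + mass μ univ * mass μ B * (μ x * (if x ∈ starUp A c then 1 else 0)) := by
    intro x; unfold coefStar; ring
  have hind : ∀ S : Finset α, ∑ x, μ x * (if x ∈ S then (1 : ℝ) else 0) = mass μ S := by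
    intro S
    simp only [mul_ite, mul_one, mul_zero]
    rw [Finset.sum_ite_mem, Finset.univ_inter]
    rfl
  rw [Finset.sum_congr rfl (fun x _ => hpt x), Finset.sum_add_distrib, Finset.sum_add_distrib, ← Finset.mul_sum,
    ← Finset.mul_sum, ← Finset.mul_sum, hind, hind]
  have hZ : ∑ x, μ x = mass μ univ := rfl
  rw [hZ]
  ring

/-- **Total load ≤ total capacity**: `Σ_{y∈P} H y ≤ 2Z²·m(P)`, from FKG for the top sections `A*, B*` (`A* ∩ B* = P`) and
`m(A) ≤ m(A*)`, `m(B) ≤ m(B*)`: `Zπ + ab − a·m(B*) − b·m(A*) ≥ (m(A*) − a)(m(B*) − b) ≥ 0`. [this work] -/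
theorem sum_load_le {μ : α → ℝ} (hμ₀ : 0 ≤ μ) (hμ : ∀ a b, μ a * μ b ≤ μ (a ⊓ b) * μ (a ⊔ b))
    {A B : Finset α} (hA : IsUpperSet (A : Set α)) (hB : IsUpperSet (B : Set α)) {c : α}
    (hAB : A ∩ B = principalUp c) :
    ∑ y ∈ principalUp c, load μ A B c y ≤ 2 * mass μ univ ^ 2 * mass μ (principalUp c) := by
  rw [sum_load_eq, sum_mul_coefStar_eq, hAB]
  have hZ := mass_nonneg hμ₀ (univ : Finset α)
  have haa : mass μ A ≤ mass μ (starUp A c) := mass_mono hμ₀ (subset_starUp A c)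
  have hbb : mass μ B ≤ mass μ (starUp B c) := mass_mono hμ₀ (subset_starUp B c)
  have hfkg := fkg_upperSet_mass hμ₀ hμ (isUpperSet_starUp A c) (isUpperSet_starUp B c)
  rw [starUp_inter_starUp hA hB hAB] at hfkg
  -- `2Z²π − total = Z·(Zπ − a* b*) + Z·(a* − a)(b* − b) ≥ 0`
  have key : 2 * mass μ univ ^ 2 * mass μ (principalUp c) -
      (mass μ univ * (mass μ univ * mass μ (principalUp c) - mass μ A * mass μ B)
        + mass μ univ * mass μ A * mass μ (starUp B c) + mass μ univ * mass μ B * mass μ (starUp A c)) =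
      mass μ univ * (mass μ univ * mass μ (principalUp c) - mass μ (starUp A c) * mass μ (starUp B c))
        + mass μ univ * ((mass μ (starUp A c) - mass μ A) * (mass μ (starUp B c) - mass μ B)) := by ring
  have t1 : 0 ≤ mass μ univ * (mass μ univ * mass μ (principalUp c) - mass μ (starUp A c) * mass μ (starUp B c)) :=
    mul_nonneg hZ (sub_nonneg.2 hfkg)
  have t2 : 0 ≤ mass μ univ * ((mass μ (starUp A c) - mass μ A) * (mass μ (starUp B c) - mass μ B)) :=
    mul_nonneg hZ (mul_nonneg (sub_nonneg.2 haa) (sub_nonneg.2 hbb))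
  linarith

/-! ### The theorem -/

/-- **Sahi's `C₃` for every FKG weight when the intersection of the last two slots is principal.**  For a nonnegative
log-supermodular weight `μ` on a finite distributive lattice and up-sets `U, A, B` with `A ∩ B = {x | c ≤ x}`:
`0 ≤ latticeE3 μ U A B`. [this work] -/
theorem latticeE3_nonneg_of_inter_eq_principalUp {μ : α → ℝ} (hμ₀ : 0 ≤ μ)
    (hμ : ∀ a b, μ a * μ b ≤ μ (a ⊓ b) * μ (a ⊔ b)) {U A B : Finset α}
    (hU : IsUpperSet (U : Set α)) (hA : IsUpperSet (A : Set α)) (hB : IsUpperSet (B : Set α)) (c : α)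
    (hAB : A ∩ B = principalUp c) : 0 ≤ latticeE3 μ U A B := by
  have hZ := mass_nonneg hμ₀ (univ : Finset α)
  have hP := mass_nonneg hμ₀ (principalUp c)
  rcases hP.eq_or_lt with hP0 | hPpos
  · -- degenerate case `m(P) = 0`: then `m(A) m(B) ≤ Z·m(P) = 0`, one of `A, B` is null, and `latticeE3 = 0`
    have hfkg := fkg_upperSet_mass hμ₀ hμ hA hB
    rw [hAB, ← hP0, mul_zero] at hfkg
    have ha := mass_nonneg hμ₀ A
    have hb := mass_nonneg hμ₀ B
    have hzero : ∀ S T : Finset α, mass μ T = 0 → S ⊆ T → mass μ S = 0 := fun S T hT hST =>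
      le_antisymm (le_trans (mass_mono hμ₀ hST) (le_of_eq hT)) (mass_nonneg hμ₀ S)
    have hUAB : mass μ (U ∩ A ∩ B) = 0 :=
      hzero _ _ hP0.symm (by rw [Finset.inter_assoc, hAB]; exact Finset.inter_subset_right)
    have hABm : mass μ (A ∩ B) = 0 := by rw [hAB]; exact hP0.symm
    rcases mul_eq_zero.1 (le_antisymm hfkg (mul_nonneg ha hb)) with ha0 | hb0
    · have hUA : mass μ (U ∩ A) = 0 := hzero _ _ ha0 Finset.inter_subset_right
      unfold latticeE3
      rw [hUAB, ha0, hUA, hABm]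
      simp
    · have hUB : mass μ (U ∩ B) = 0 := hzero _ _ hb0 Finset.inter_subset_right
      unfold latticeE3
      rw [hUAB, hb0, hUB, hABm]
      simp
  · -- main case
    have hV : IsUpperSet (((U ∩ principalUp c : Finset α)) : Set α) := by
      rw [Finset.coe_inter]; exact hU.inter (isUpperSet_principalUp c)
    have hmV := mass_nonneg hμ₀ (U ∩ principalUp c)
    have h3 := sum_load_mul_le hμ₀ hμ hA hB c hV Finset.inter_subset_right
    have h4 := sum_load_le hμ₀ hμ hA hB hAB
    -- `(Σ_V H)·m(P) ≤ (Σ_P H)·m(V) ≤ 2Z² m(P) m(V)`; divide by `m(P) > 0`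
    have h5 : (∑ y ∈ U ∩ principalUp c, load μ A B c y) * mass μ (principalUp c) ≤
        (2 * mass μ univ ^ 2 * mass μ (U ∩ principalUp c)) * mass μ (principalUp c) :=
      calc (∑ y ∈ U ∩ principalUp c, load μ A B c y) * mass μ (principalUp c)
          ≤ (∑ y ∈ principalUp c, load μ A B c y) * mass μ (U ∩ principalUp c) := h3
        _ ≤ (2 * mass μ univ ^ 2 * mass μ (principalUp c)) * mass μ (U ∩ principalUp c) :=
            mul_le_mul_of_nonneg_right h4 hmV
        _ = (2 * mass μ univ ^ 2 * mass μ (U ∩ principalUp c)) * mass μ (principalUp c) := by ring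
    have h6 : ∑ y ∈ U ∩ principalUp c, load μ A B c y ≤ 2 * mass μ univ ^ 2 * mass μ (U ∩ principalUp c) :=
      le_of_mul_le_mul_right h5 hPpos
    have h1 := latticeE3_satUp_le hμ₀ hμ hU hA hB hAB
    have h2 := latticeE3_satUp_ge (U := U) hμ₀ hAB
    linarith

omit [DistribLattice α] [DecidableLE α] in
/-- `latticeE3` is symmetric under exchanging the first two slots. [folklore] -/
theorem latticeE3_comm₁₂ (μ : α → ℝ) (A B C : Finset α) : latticeE3 μ A B C = latticeE3 μ B A C := by
  unfold latticeE3
  rw [Finset.inter_comm B A]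
  ring

omit [DistribLattice α] [DecidableLE α] in
/-- `latticeE3` is symmetric under exchanging the last two slots. [folklore] -/
theorem latticeE3_comm₂₃ (μ : α → ℝ) (A B C : Finset α) : latticeE3 μ A B C = latticeE3 μ A C B := by
  unfold latticeE3
  rw [Finset.inter_right_comm A C B, Finset.inter_comm C B]
  ring

/-- The same theorem with the principal intersection formed by the FIRST TWO slots: `U ∩ A = {x | c ≤ x}` gives
`0 ≤ latticeE3 μ U A B`. [this work] -/
theorem latticeE3_nonneg_of_inter_eq_principalUp₁₂ {μ : α → ℝ} (hμ₀ : 0 ≤ μ)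
    (hμ : ∀ a b, μ a * μ b ≤ μ (a ⊓ b) * μ (a ⊔ b)) {U A B : Finset α}
    (hU : IsUpperSet (U : Set α)) (hA : IsUpperSet (A : Set α)) (hB : IsUpperSet (B : Set α)) (c : α)
    (hUA : U ∩ A = principalUp c) : 0 ≤ latticeE3 μ U A B := by
  rw [latticeE3_comm₂₃, latticeE3_comm₁₂]
  exact latticeE3_nonneg_of_inter_eq_principalUp hμ₀ hμ hB hU hA c hUA

/-- The same theorem with the principal intersection formed by the FIRST AND THIRD slots: `U ∩ B = {x | c ≤ x}` gives
`0 ≤ latticeE3 μ U A B`. [this work] -/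
theorem latticeE3_nonneg_of_inter_eq_principalUp₁₃ {μ : α → ℝ} (hμ₀ : 0 ≤ μ)
    (hμ : ∀ a b, μ a * μ b ≤ μ (a ⊓ b) * μ (a ⊔ b)) {U A B : Finset α}
    (hU : IsUpperSet (U : Set α)) (hA : IsUpperSet (A : Set α)) (hB : IsUpperSet (B : Set α)) (c : α)
    (hUB : U ∩ B = principalUp c) : 0 ≤ latticeE3 μ U A B := by
  rw [latticeE3_comm₁₂]
  exact latticeE3_nonneg_of_inter_eq_principalUp hμ₀ hμ hA hU hB c hUB

/-- **Transport form** (seat P4's `HasC3Flow`, via Strassen `…C3TransportStrassen`): under every nonnegative log-supermodular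
weight, a pair of up-sets with principal intersection admits a `C₃`-flow — the supply
`a·μ|_{B∖A} + b·μ|_{A∖B} + Cov·μ|_{(A∩B)ᶜ}` can be moved monotonically upward into `A ∩ B` within the capacity
`((1−a)+(1−b)−Cov)·μ|_{A∩B}`. [this work] -/
theorem hasC3Flow_of_inter_eq_principalUp {μ : α → ℝ} (hμ₀ : 0 ≤ μ)
    (hμ : ∀ a b, μ a * μ b ≤ μ (a ⊓ b) * μ (a ⊔ b)) {A B : Finset α}
    (hA : IsUpperSet (A : Set α)) (hB : IsUpperSet (B : Set α)) (c : α) (hAB : A ∩ B = principalUp c) :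
    HasC3Flow μ A B :=
  hasC3Flow_of_forall_upperSet fun _ hU => latticeE3_nonneg_of_inter_eq_principalUp hμ₀ hμ hU hA hB c hAB

end Summit.CriticalPhenomena.PercolationContinuityZ3.Theorems.SahiE3PrincipalMeetFKG
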